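import Summits.QuantumFields.YangMills.Theorems.UnitScaleTiltProp7ChartT3Defs
import Summits.QuantumFields.YangMills.Theorems.UnitScaleTiltProp7AxialReprPrint
import Literature.MathematicalPhysics.QuantumFieldTheory.Balaban1983to89.B11Prop3Concrete
import HarnessLib

/-!
# Route `UnitScaleTilt`, crux K1 child «MinimiserStabilityRegPr» (stmt-QuantumFields-19200), skeleton v10 stub EX, route (α), cut (S3)(i) — DEFINITIONS FILE 2:
# **THE SPLIT OF THE CHART ROW `Chart112T3` BY PRINT** (★★OWNER 02:08:50Z (2)–(3), 02:15:05Z): **`Chart47T3`** = [Balaban1985Variational] PROPOSITION 3 (the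
# linearizing transformation (47) `A = A′ − HD(A′)` of the top-level averaging, H abstract) AT THE T³ OBJECTS IN THE BASED LETTERS OF `S_print` (the carrier of the
# port `Prop7Chart47T3.chart47T3_of_regPr` from `B11Prop3Concrete.prop3_concrete`), **`ChartSigmaT3`** = the (1.29)-RESTRICTED AXIAL GAUGE FIXING relative to `U₀`
# ([Balaban1985RegularSpaces] p. 81 ∕ [Balaban1985Variational] p. 299 «we apply to it a gauge transformation u satisfying the conditions R̄₀u = 1 on Λ_j and such
# that (U₁U₀)ᵘ satisfies the axial gauge conditions Ax_k(𝔅_k, U₀)»), **`Chart5T3`** = the displayed remainder (Prop. 5's composite (112) + (123)–(140) + the fibre ∕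
# pin junction), with the objects the port needs: the fine ∕ coarse `ℤ³` boxes of one period, the restricted based pullback `resPull`, print's constant `C₂(Lᵏ)²`
# (`C2K`) and the map `D` of (49) (`Dmap` = r08's selector `B11Prop3Model.Dfix` for the concrete `C_k` of the based pullback)

Cell `ym3-torus` ∕ width seat `ym-ust-19200-w1` (gen 2).  YM₃ on T³ is ladder rung R3, not the Clay problem; nothing here is a claim about the crux or the gap.

THE PRINT.  [Balaban1985Variational] p. 285: «We will construct the linearizing transformation in the form A = A′ − HD(A′), (47) where D will be a mapping defined
on configurations A′ and with values in configurations on 𝔅_k. This mapping has to satisfy the equations … C_j(LʲηA′ − LʲηHD(A′)) = D(A′) on Λ_j. (49)»; p. 289: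
«Proposition 3. The transformation (47) satisfying the identity (48), i.e. linearizing the averaging operation Q(ηA), is defined and analytic for A′ satisfying (43)
with ε₃ sufficiently small (e.g. 18C₂B₀dc₁(½)ε₃ ≦ 1, 2ε₃ ≦ c₄). The range of this transformation contains the set (43) with ε₂ ≦ ¼ε₃, and is contained in the
corresponding set with 2ε₃ instead of ε₂. The function D(A′) satisfies the bound (55)»; (55) p. 286: «|D(A′)| ≦ 4C₂|A′|²₍₋₁₎»; p. 294 (112); p. 299 (quoted in
`Prop7ChartT3Defs`).  [Balaban1985RegularSpaces] p. 81: «We have to describe more exactly the set of configurations obtained by transformation of 𝔅_k(𝔅_k, V) ∩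
Ax_k(𝔅_k, U₀) using the gauge transformations u … restricted additionally by the conditions (R̄₀uʲ)(y) = 1 for y ∈ Λ_j, j = 0, 1, …, k. (1.29)».

DECLARED READINGS ∕ HONEST SCOPE.  (i) Hypothesis SHAPES with bodies + bookkeeping objects; no theorem here claims `Chart47T3`, `ChartSigmaT3` or `Chart5T3`
(`Chart47T3` is PROVED in the sibling file `…Prop7Chart47T3`; the other two are displayed).  (ii) CONVENTION: `Chart47T3` lives in the BASED letters of `S_print` (top
level `k = K − n`, all `Ω_j = T_η`: the `k`-fold average of [Balaban1985Averaging] (43)∕(127) of the pullback BASED AT `x₀ = basePt F n K`, `B7Prop5GeneralInduction.CCovIter`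
= `C_k(U₀♯, ·)`), the coarse data `D(A′)` indexed by ONE PERIOD of level-`k` `ℤ³` bonds (`coarseBox`), the letter `H` of (45) an ABSTRACT linear map from coarse data to
fine torus fields with ‖HX‖ ≤ B₀‖X‖ ([5] Thm 3.12, in-edge N06 — NOT constructed); the junction of this convention with the (115)-letters of `Prop7SectET3Objects`
(periodic lattice via `siteEquiv`, background `bgOfCfg`) and with the family's descent fibre `T3ConstrainedMinimiser.fibre` (CARD-19200-V3-g8 §1(c) seam) is part of the
DISPLAYED row `Chart5T3`.  (iii) `ChartSigmaT3` is V-free: pure (1.29)-normalised axial gauge fixing (the tree has the (1.14)-normalised version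
`B8Eq119TwistedAxial.twistedFix_global` and the ⇒-direction (1.29),(1.30) ⇒ (1.31) `B8Eq131Derivation` ∕ `B8Eq137QjEqB.Qj_eq_Bint_of_inAx_restr129`; this ∃ is M-sized,
not landed here).  (iv) Tree units: at the T³ member `Lᵏη = 1`, so print's `ε₃(Lʲη)⁻¹` radii are plain sup-norm radii `ε`.  Count-neutral toward stmt-QuantumFields-19200
(`--supports`); nothing continuum ∕ OS ∕ mass-gap ∕ Clay.

References: T. Bałaban, CMP **102** (1985) 277–309 [Balaban1985Variational] ((43)–(49) p.285, (55) p.286, Prop. 3 p.289, (101)–(104) p.293, (111)–(112) p.294, (115)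
p.294, (123)–(140) pp.296–299, p.299); CMP **99** (1985) 75–102 [Balaban1985RegularSpaces] ((1.19) p.79, (1.28)–(1.31) pp.81–82, Prop. 7 (1.144) p.100); CMP **98**
(1985) 17–51 [Balaban1985Averaging] ((43) p.24, (127) p.37, (134)–(135) p.38).
-/

noncomputable section

open scoped Matrix.Norms.L2Operator

namespace Summit.QuantumFields.YangMills.Theorems.Prop7ChartT3

open Literature.MathematicalPhysics.QuantumFieldTheory.Balaban1983to89
open T3ContinuumYM3Torus T3PrintedRegularMinimiser
open T3UnitLawDensityEML (ℰp)
open T3ConstrainedMinimiser (fibre)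
open T3SectALandauChart (bgUnits emb15)
open B7Prop1Explicit renaming Site → LSite
open B7Prop5GeneralInduction (CCovIter)
open B9SectCLatticeCarrier (Bond)
open B10Eq27TorusAxialLog (pull transl)
open B11Eq44Concrete (Cmap)
open B11Prop3Model (Dfix)
open B11Eq115Space (NegSize Space115)
open B11Eq111FrakG (nabla115)
open B11Eq98CurrentSlot (Jcur)
open Summit.QuantumFields.YangMills.Theorems.Prop7SectET3Transport (periodsT3 bgOfCfg)
open Summit.QuantumFields.YangMills.Theorems.Prop7SPrint (basePt IsAxialPrint RestrictedPrint AvgCondPrint IsLandauPrint)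
open Summit.QuantumFields.YangMills.Theorems.Prop7TPrint (nMax19 expHermField)

variable (F : T3Family) (n K : ℕ)

/-! ## §1 The objects of the port: one period of the universal cover, the restricted based pullback, `C₂(Lᵏ)²`, `D` -/

/-- **THE FINE BOX `[−N, 2N)³ × {directions}`, `N = sitesPerDir 0`** — a finite set of fine `ℤ³` bonds containing the least-absolute-value representatives of all torus bonds
AND the averaging cones `B^k(c₋) ∪ B^k(c₊)` of every coarse bond of `coarseBox` (the carrier `S` of `B11Eq44Concrete.Cmap`). [cite: Balaban1985Averaging, p.24 (sentence after (43))] -/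
def fineBox : Finset (LSite (F.P K).d × Fin (F.P K).d) :=
  (Fintype.piFinset fun _ : Fin (F.P K).d =>
      Finset.Ico (-(((F.P K).sitesPerDir 0 : ℕ) : ℤ)) (2 * (((F.P K).sitesPerDir 0 : ℕ) : ℤ))) ×ˢ Finset.univ

/-- **THE COARSE BOX `[0, N_k)³ × {directions}`, `N_k = sitesPerDir (K − n)`** — one period of level-`k` `ℤ³` bonds = the bonds of `Λ_k = T^{(k)}` read on the universal
cover (the carrier `T` of `B11Eq44Concrete.Cmap`; the index set of the coarse data `D(A′)`, `B`). [cite: Balaban1985Variational, (45) p.285, (49) p.285] -/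
def coarseBox : Finset (LSite (F.P K).d × Fin (F.P K).d) :=
  (Fintype.piFinset fun _ : Fin (F.P K).d => Finset.Ico (0 : ℤ) (((F.P K).sitesPerDir (K - n) : ℕ) : ℤ)) ×ˢ Finset.univ

/-- **THE RESTRICTED BASED PULLBACK**: a fine torus field `A′` read on the fine box through the pullback based at `x₀ = basePt F n K` (`A′♯(z, μ) = A′(x₀ + z, μ)`),
`ℂ`-linear. [cite: Balaban1985Averaging, (8) p.19; Balaban1987RG1, (0.1) p.251] -/
def resPull : (PBond (F.P K) 0 → Matrix (Fin 2) (Fin 2) ℂ) →ₗ[ℂ] (↥(fineBox F K) → Matrix (Fin 2) (Fin 2) ℂ) where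
  toFun A s := pull A (basePt F n K) s.1.1 s.1.2
  map_add' _ _ := by funext s; rfl
  map_smul' _ _ := by funext s; rfl

/-- **PRINT'S `C₂(Lʲ)²` OF (44) AT THE T³ MEMBER** (`B7Eq123General`'s `8C₁e^{4cα₀}` with `α₀ = 2a`, `a` the radius of `U₀`'s regular class, `j = k = K − n`; tree units).
[cite: Balaban1985Variational, (44) p.285; Balaban1985Averaging, (135) p.38] -/
def C2K (a : ℝ) : ℝ :=
  (8 * (131072 * (((F.P K).d : ℝ) + 1) ^ 2) * Real.exp (4 * (800 * (((F.P K).d : ℝ) + 1) ^ 2 * (((F.P K).d : ℝ) + 4)) * (2 * a)))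
    * (((F.P K).L : ℝ) ^ (K - n)) ^ 2

/-- **THE MAP `D` OF (47)∕(49) AT THE T³ OBJECTS**: r08's fixed-point selector `B11Prop3Model.Dfix` for the CONCRETE remainder `C_k(U₀♯, ·)` of [4] on the fine ∕ coarse boxes
(`B11Eq44Concrete.Cmap` at the based pullback `U₀♯` of the background), the letter `H` read on the fine box through `resPull`. [cite: Balaban1985Variational, (47)–(50) p.285] -/
def Dmap (a : ℝ) (U₀ : GaugeField (F.P K) 0 (Matrix.specialUnitaryGroup (Fin 2) ℂ))
    (H : (↥(coarseBox F n K) → Matrix (Fin 2) (Fin 2) ℂ) →ₗ[ℂ] (PBond (F.P K) 0 → Matrix (Fin 2) (Fin 2) ℂ)) :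
    (↥(fineBox F K) → Matrix (Fin 2) (Fin 2) ℂ) → (↥(coarseBox F n K) → Matrix (Fin 2) (Fin 2) ℂ) :=
  Dfix (Cmap (F.P K).L (pull (bgUnits F K U₀) (basePt F n K)) (fineBox F K) (coarseBox F n K) (K - n)) ((resPull F n K) ∘ₗ H) (C2K F n K a)

/-! ## §2 The three rows of the split -/

/-- **CHART-47-T³ — [Balaban1985Variational] PROPOSITION 3 AT THE T³ OBJECTS, BASED LETTERS** (member `F`, `n < K`, `k = K − n`; background `U₀`, radius `a` of its regular
class; sup-norm radius `ε` = print's `ε₃`; the letter `H` abstract): with `D = Dmap F n K a U₀ H`, for fine torus fields `A′`: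
(49) «C_k(Lᵏη(A′ − HD(A′))) = D(A′) on Λ_k» — at every coarse bond of one period, the concrete remainder `C_k(U₀♯, (A′ − HD(A′))♯)` of the based pullbacks IS `D(A′)`;
«the range … contains the set (43) with ε₂ ≦ ¼ε₃»; «… is contained in the corresponding set with 2ε₃»; (55) «|D(A′)| ≦ 4C₂|A′|²».  PROVED (sibling file
`Prop7Chart47T3.chart47T3_of_regPr`) from `B11Prop3Concrete.prop3_concrete`; asserted for nothing here.
[cite: Balaban1985Variational, Prop. 3 p.289, (47)–(49) p.285, (55) p.286, (43) p.285] -/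
def Chart47T3 (a ε : ℝ) (U₀ : GaugeField (F.P K) 0 (Matrix.specialUnitaryGroup (Fin 2) ℂ))
    (H : (↥(coarseBox F n K) → Matrix (Fin 2) (Fin 2) ℂ) →ₗ[ℂ] (PBond (F.P K) 0 → Matrix (Fin 2) (Fin 2) ℂ)) : Prop :=
  (∀ A' : PBond (F.P K) 0 → Matrix (Fin 2) (Fin 2) ℂ, ‖A'‖ < ε → ∀ c : ↥(coarseBox F n K),
      CCovIter (F.P K).L (pull (bgUnits F K U₀) (basePt F n K))
        (pull (A' - H (Dmap F n K a U₀ H (resPull F n K A'))) (basePt F n K)) (K - n) c.1.1 c.1.2 =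
      Dmap F n K a U₀ H (resPull F n K A') c) ∧
  (∀ ε₂ : ℝ, ε₂ ≤ ε / 4 → ∀ A : PBond (F.P K) 0 → Matrix (Fin 2) (Fin 2) ℂ, ‖A‖ < ε₂ →
    ∃ A' : PBond (F.P K) 0 → Matrix (Fin 2) (Fin 2) ℂ, ‖A'‖ < ε ∧ A' - H (Dmap F n K a U₀ H (resPull F n K A')) = A) ∧
  (∀ A' : PBond (F.P K) 0 → Matrix (Fin 2) (Fin 2) ℂ, ‖A'‖ < ε → ‖A' - H (Dmap F n K a U₀ H (resPull F n K A'))‖ < 2 * ε) ∧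
  (∀ A' : PBond (F.P K) 0 → Matrix (Fin 2) (Fin 2) ℂ, ‖A'‖ < ε → ‖Dmap F n K a U₀ H (resPull F n K A')‖ ≤ 4 * C2K F n K a * ‖A'‖ ^ 2)

/-- **CHART-Σ-T³ — THE (1.29)-RESTRICTED AXIAL GAUGE FIXING RELATIVE TO `U₀`, BASED LETTERS** (V-free): every small perturbation `e^{iX}` of the background (`X` bondwise
Hermitian traceless, (19)-size `< e`) is carried by SOME gauge transformation `u` with the based restriction (1.29) (`RestrictedPrint`) into print's axial gauge (1.19) relative
to `U₀` (`IsAxialPrint`) — [6] p. 81 ∕ [Balaban1985Variational] p. 299 «we apply to it a gauge transformation u satisfying the conditions R̄₀u = 1 on Λ_j and such that the gauge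
transformed configuration (U₁U₀)ᵘ satisfies the axial gauge conditions Ax_k(𝔅_k, U₀)».  DISPLAYED (the tree has the (1.14)-normalised fixing
`B8Eq119TwistedAxial.twistedFix_global` and the (4)-group representative `Prop7AxialReprPrint.axialRepr_print_based`, not this (1.29)-normalised one).
[cite: Balaban1985RegularSpaces, (1.29) p.81, (1.19) p.79, p.81; Balaban1985Variational, p.299] -/
def ChartSigmaT3 (e : ℝ) (U₀ : GaugeField (F.P K) 0 (Matrix.specialUnitaryGroup (Fin 2) ℂ)) : Prop :=
  ∀ X : PBond (F.P K) 0 → Matrix (Fin 2) (Fin 2) ℂ, (∀ b : PBond (F.P K) 0, (X b).IsHermitian ∧ Matrix.trace (X b) = 0) →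
    nMax19 F n K U₀ X < e →
      ∃ u : GaugeTransf (F.P K) 0 (Matrix.specialUnitaryGroup (Fin 2) ℂ),
        RestrictedPrint F n K U₀ u ∧ IsAxialPrint F n K U₀ (GaugeField.gaugeAct u (emb15 U₀ (expHermField X)))

/-- **CHART-5-T³ — THE DISPLAYED REMAINDER OF THE ROW: PROP. 5's COMPOSITE (112) + (123)–(140) + THE FIBRE ∕ PIN JUNCTION** (XL): GIVEN Prop. 3's chart at the T³
objects (`Chart47T3 … a ε U₀ H`), every solution `A₁` of (111)[𝒢, W, H₁B] in the (115)-ball `ε₄` yields the exponent `X = η(A′ − HD(A′))`, `A′ = A₁ + H₁B`, bondwise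
Hermitian traceless, of (19)-size `≤ M(‖A₁‖ + ‖H₁B‖)` («satisfying all the conditions (19)–(21) with ε₂ = O(1)C₁B₃ε₁», pp. 296–299: (57)–(58), (103), (136), (139)–(140)),
with (21) `IsLandauPrint` ((76) by (45) `RD*H = 0` and (102)), and such that EVERY (1.29)-restricted axial representative `(e^{iX}U₀)ᵘ` lies in the descent fibre of `V`
((20) via (48) «Q_j(η(A′ − HD(A′))) = LʲηQ_jA′», (102), `QH₁B = B`, B pinned to (1.31) at `(V, U₀)` (PIN-B), [6] Prop. 7, and the junction of the based letters with the
(115)-letters at `siteEquiv`∕`bgOfCfg` and with the family's (0.4)-descent — CARD-19200-V3-g8 §1(c)).  ASSERTED FOR NOTHING; the letters `𝒢, W, H₁, B, H` are the abstract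
ones of `Chart112T3` ∕ `Chart47T3`. [cite: Balaban1985Variational, Prop. 5 p.294, (112) p.294, (48) p.285, (76) p.289, (102)–(103) p.293, (123)–(140) pp.296–299, p.299; Balaban1985RegularSpaces, (1.31) p.82, Prop. 7 (1.144) p.100] -/
def Chart5T3 (h : n ≤ K) [Fact (0 < (F.L : ℝ))] [Fact (0 < ((F.L : ℝ)⁻¹) ^ (K - n))] (ε₄ M : ℝ)
    (V : GaugeField (F.P n) 0 (Matrix.specialUnitaryGroup (Fin 2) ℂ)) (U₀ : GaugeField (F.P K) 0 (Matrix.specialUnitaryGroup (Fin 2) ℂ))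
    (𝒢 : NegSize (F.L : ℝ) (((F.L : ℝ)⁻¹) ^ (K - n)) (fun _ : Bond 3 (periodsT3 F K) => K - n) 3 (Matrix (Fin 2) (Fin 2) ℂ) →L[ℂ]
          Space115 (F.L : ℝ) (((F.L : ℝ)⁻¹) ^ (K - n)) (fun _ : Bond 3 (periodsT3 F K) => K - n) (fun _ : Bond 3 (periodsT3 F K) × Fin 3 => K - n)
            (nabla115 (((F.L : ℝ)⁻¹) ^ (K - n)) (bgOfCfg F K U₀)))
    (W : Space115 (F.L : ℝ) (((F.L : ℝ)⁻¹) ^ (K - n)) (fun _ : Bond 3 (periodsT3 F K) => K - n) (fun _ : Bond 3 (periodsT3 F K) × Fin 3 => K - n)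
            (nabla115 (((F.L : ℝ)⁻¹) ^ (K - n)) (bgOfCfg F K U₀)) →
          NegSize (F.L : ℝ) (((F.L : ℝ)⁻¹) ^ (K - n)) (fun _ : Bond 3 (periodsT3 F K) => K - n) 3 (Matrix (Fin 2) (Fin 2) ℂ))
    {β : Type} [Fintype β]
    (H₁ : (β → Matrix (Fin 2) (Fin 2) ℂ) →L[ℂ]
          Space115 (F.L : ℝ) (((F.L : ℝ)⁻¹) ^ (K - n)) (fun _ : Bond 3 (periodsT3 F K) => K - n) (fun _ : Bond 3 (periodsT3 F K) × Fin 3 => K - n)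
            (nabla115 (((F.L : ℝ)⁻¹) ^ (K - n)) (bgOfCfg F K U₀)))
    (B : β → Matrix (Fin 2) (Fin 2) ℂ)
    (a ε : ℝ) (H : (↥(coarseBox F n K) → Matrix (Fin 2) (Fin 2) ℂ) →ₗ[ℂ] (PBond (F.P K) 0 → Matrix (Fin 2) (Fin 2) ℂ)) : Prop :=
  Chart47T3 F n K a ε U₀ H →
    ∀ A₁ : Space115 (F.L : ℝ) (((F.L : ℝ)⁻¹) ^ (K - n)) (fun _ : Bond 3 (periodsT3 F K) => K - n) (fun _ : Bond 3 (periodsT3 F K) × Fin 3 => K - n)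
            (nabla115 (((F.L : ℝ)⁻¹) ^ (K - n)) (bgOfCfg F K U₀)),
      ‖A₁‖ < ε₄ → A₁ + 𝒢 (Jcur (bgOfCfg F K U₀)) + 𝒢 (W (A₁ + H₁ B)) = 0 →
        ∃ X : PBond (F.P K) 0 → Matrix (Fin 2) (Fin 2) ℂ,
          (∀ b : PBond (F.P K) 0, (X b).IsHermitian ∧ Matrix.trace (X b) = 0) ∧
          nMax19 F n K U₀ X ≤ M * (‖A₁‖ + ‖H₁ B‖) ∧ IsLandauPrint F n K U₀ X ∧
          ∀ u : GaugeTransf (F.P K) 0 (Matrix.specialUnitaryGroup (Fin 2) ℂ), RestrictedPrint F n K U₀ u →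
            IsAxialPrint F n K U₀ (GaugeField.gaugeAct u (emb15 U₀ (expHermField X))) →
              GaugeField.gaugeAct u (emb15 U₀ (expHermField X)) ∈ fibre F ℰp n K h V

/-! ## §3 Unfoldings (definitional) -/

section Unfold

/-- Membership in the fine box, coordinatewise. [cite: Balaban1987RG1, (0.1) p.251] -/
theorem mem_fineBox_iff (x : LSite (F.P K).d) (κ : Fin (F.P K).d) :
    (x, κ) ∈ fineBox F K ↔ ∀ i, -(((F.P K).sitesPerDir 0 : ℕ) : ℤ) ≤ x i ∧ x i < 2 * (((F.P K).sitesPerDir 0 : ℕ) : ℤ) := by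
  simp only [fineBox, Finset.mem_product, Fintype.mem_piFinset, Finset.mem_Ico, Finset.mem_univ, and_true]

/-- Membership in the coarse box, coordinatewise. [cite: Balaban1987RG1, (0.1) p.251] -/
theorem mem_coarseBox_iff (z : LSite (F.P K).d) (κ : Fin (F.P K).d) :
    (z, κ) ∈ coarseBox F n K ↔ ∀ i, 0 ≤ z i ∧ z i < (((F.P K).sitesPerDir (K - n) : ℕ) : ℤ) := by
  simp only [coarseBox, Finset.mem_product, Fintype.mem_piFinset, Finset.mem_Ico, Finset.mem_univ, and_true]

/-- The restricted pullback, bondwise: `(resPull A) (z, μ) = A(x₀ + z, μ)`. [cite: Balaban1985Averaging, (8) p.19] -/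
theorem resPull_apply (A : PBond (F.P K) 0 → Matrix (Fin 2) (Fin 2) ℂ) (s : ↥(fineBox F K)) :
    resPull F n K A s = A ⟨transl (basePt F n K) s.1.1, s.1.2⟩ := rfl

/-- `Dmap` unfolded. [cite: Balaban1985Variational, (49)–(50) p.285] -/
theorem Dmap_def (a : ℝ) (U₀ : GaugeField (F.P K) 0 (Matrix.specialUnitaryGroup (Fin 2) ℂ))
    (H : (↥(coarseBox F n K) → Matrix (Fin 2) (Fin 2) ℂ) →ₗ[ℂ] (PBond (F.P K) 0 → Matrix (Fin 2) (Fin 2) ℂ)) :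
    Dmap F n K a U₀ H =
      Dfix (Cmap (F.P K).L (pull (bgUnits F K U₀) (basePt F n K)) (fineBox F K) (coarseBox F n K) (K - n)) ((resPull F n K) ∘ₗ H) (C2K F n K a) := rfl

end Unfold

end Summit.QuantumFields.YangMills.Theorems.Prop7ChartT3

end
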